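import Summits.QuantumFields.BalabanUV.Beta.FP.MarginalUniquenessWard

/-!
# `BalabanUV.Beta.FP.MarginalUniquenessWardMinimal` — road «FP» for binder row D1, leaf H2-G (vertex germ): THE MINIMAL HYPOTHESIS SET.
# Ward against the isotropic transverse quadratic germ + the `p`-part of ONE Bose exchange (legs 1 ↔ 3) ALREADY force `L = cQ · ymGerm`;
# reflections, permutations, the 1 ↔ 2 exchange and the `q`-part of 1 ↔ 3 are IDLE — and the 1 ↔ 3 exchange CANNOT be dropped.

HONEST DEPENDENCY (page 1, mandatory): continuum YM on T⁴ ⇐ BetaPertH ∧ nine spine estimates (0/9 proved); BetaPertH ⇐ (D1) ∧ (D4) ∧ CAP+tail;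
G-an2-4 gates asym, D1 and NE2/3/4.  HONEST FRAMING (cell contract, verbatim): «discharging `BetaPertH` makes Bałaban's UV stability UNCONDITIONAL —
a real constructive-QFT result; it is NOT the continuum limit and NOT the Clay problem.»  THIS MODULE DISCHARGES NOTHING of the wall: pure finite-dimensional
linear algebra over `ℝ` (Mathlib only) on the coefficient tables of `FP/MarginalUniqueness` (`CubicGerm`, `PermInvariant`, `FlipInvariant`, `Anti12`, `Anti13`,
`ymGerm`) and `FP/WardNormalisation` (`WardGerm`, `quadGerm`, `e`, `nsq`).  No `def`, no notation, no `def … : Prop`, nothing cited, 0 sorry; NOT D1, NOT BetaPertH, NOT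
continuum, NOT Clay.

ABSOLUTE RULE (cell charter, verbatim): «No internally-minted statement may enter as a cited fact. Every hypothesis is either kernel-proved in this package or a
verbatim quotation of a PUBLISHED theorem with page reference. The manuscript(s) under audit are NOT citable for their own disputed steps — they are the thing
under adjudication; programme-internal (2001/route/tribunal) claims are never citable.»

ORIGIN.  Cross-read (XREAD) of the road owner's `FP/MarginalUniquenessWard` (p231446, `cubic_eq_of_flip_bose_ward`: `FlipInvariant ∧ Anti12 ∧ Anti13 ∧ Ward ⟹
L = cQ · ymGerm`) by an NE9 idle seat, with an independent exact-arithmetic engine on the `512 + 1` unknowns: the solution space of {`Anti13` `p`-part, Ward} alone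
is already the single point `(ymGerm, cQ = 1)` (rank 512), while {`FlipInvariant`, `Anti12`, Ward} leaves a 6-parameter family (one `t_{ab}` per unordered
axis pair) of which `PermInvariant` keeps exactly the isotropic line `ymGerm + t·x` (§5).  This file is the KERNEL form of both facts.
* §1 the general `B₄`-invariant quadratic germ `quadGerm cQ α γ` at the test momenta `0`, `e_a`, `e_a + e_b` in closed form;
* §2 the Ward identity EVALUATED: (W1) `L μν aa 0 = Q(e_a)_{μν}`, (W1′) `L μν aa 1 = −Q(e_a)_{μν}`, (W5) `L μν ab 1 = −L μν ba 0` (the `q`-block is minus the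
  transpose of the `p`-block), (W2) `L μν ab 0 + L μν ba 0 = −(cQ − α)(δ_{μa}δ_{νb} + δ_{μb}δ_{νa})` for `a ≠ b`;
* §3 **`cubic_eq_of_anti13p_ward`**: `(∀ μ ν λ κ, L λ ν μ κ 0 = L μ ν λ κ 0) → WardGerm L (quadGerm cQ 0 0) → L = cQ · ymGerm` — MECHANISM: Ward fixes the
  `(λ,κ)`-diagonal and the `(λ,κ)`-symmetric part of the `p`-block and ties the `q`-block to it; a tensor symmetric in slots (1,3) and antisymmetric in
  slots (3,4) vanishes (six-step transposition chain `X ↦ −X`), so the `(λ,κ)`-antisymmetric remainder is determined too; corollaries `cubic_eq_of_anti13_ward`,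
  `cubic_eq_ym_of_anti13p_ward`, `anti13p_ward_iff`, the owner's headline with `hF`/`h12` unused, and — against the GENERAL germ `quadGerm cQ α γ` —
  **`cubic_eq_of_anti13_ward_general`**: `Anti13 ∧ Ward ⟹ L = cQ · ymGerm ∧ α = 0 ∧ γ = 0` (strengthens `WardNormalisation.cubic_eq_of_symmetric_ward`: no
  `PermInvariant`/`FlipInvariant`/`Anti12`);
* §4 NON-VACUITY: `flipInvariant_ymGerm` (not previously in the tree) and the full inhabitant of the owner's hypothesis set;
* §5 TIGHTNESS **`not_unique_without_anti13`**: for every `t ≠ 0` the germ `ymGerm + t · x`, `x_{μνλκ} = δ_{μλ}δ_{νκ} − δ_{μκ}δ_{νλ}` (`Φ_x = (B¹∧B²)·(B³∧(p+q))`,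
  Ward-trivial since `r ∧ r = 0`), is permutation AND reflection invariant, 1 ↔ 2 antisymmetric, satisfies Ward against `quadGerm 1 0 0`, and is NOT `ymGerm`.
READING FOR THE ROAD (bookkeeping only): for the marginal cubic GERM the indispensable inputs are gauge invariance (Ward) — with ALL lattice-symmetry content
sitting in the isotropy/transversality of the QUADRATIC germ `cQ(|k|²δ − kk)` (`PerfectSymbol166.W166lim_zero`) — and Bose symmetry under the 1 ↔ 3 exchange
(automatic for a trilinear form carrying `f^{abc}`); no reflection or permutation row of the cubic form itself is consumed.
Provenance: b2b-balaban-t4-ne9-formalise-leaf-03 gen 26 (prover-b2b-balaban-t4-ne9-formalise-leaf-03-g26-0), 2026-08-20, XREAD C-ne9leaf03g26-1 of p231446.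
v1.0.1 (gen 27): DOCFIX-LOW D1 of XREAD C-ne5leaf02-44 (t4-ne5-formalise-leaf-02-g19) — two docstring sentences on WHICH hypothesis set leaves the
6-parameter family; every declaration's code byte-identical to v1 (p233281).
[our object]/[folklore].
-/

namespace Summit.QuantumFields.BalabanUV.Beta.FP.MarginalUniquenessWardMinimal

open Finset
open scoped BigOperators
open Summit.QuantumFields.BalabanUV.Beta.FP.MarginalUniqueness
open Summit.QuantumFields.BalabanUV.Beta.FP.WardNormalisation
open Summit.QuantumFields.BalabanUV.Beta.FP.MarginalUniquenessWard

variable {L : CubicGerm} {cQ α γ : ℝ}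

/-! ## §1 The general `B₄`-invariant quadratic germ `quadGerm cQ α γ` at the test momenta -/

/-- [folklore] `Q(0) = 0`. -/
theorem quadGerm_zero (μ ν : Idx) : quadGerm cQ α γ (fun _ => (0:ℝ)) μ ν = 0 := by
  simp [quadGerm, nsq]

/-- [folklore] `Q(e_a)_{μν} = cQ (δ_{μν} − δ_{μa} δ_{νa}) + α δ_{μa}δ_{νa} + γ δ_{μν}δ_{μa}²`. -/
theorem quadGerm_e (a μ ν : Idx) :
    quadGerm cQ α γ (e a) μ ν = cQ * (δ μ ν - δ μ a * δ ν a) + α * (δ μ a * δ ν a) + γ * (δ μ ν * (δ μ a * δ μ a)) := by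
  have h1 : e a μ = δ μ a := rfl
  have h2 : e a ν = δ ν a := rfl
  unfold quadGerm
  rw [nsq_e, h1, h2]
  ring

/-- [folklore] `δ_{μa} δ_{μb} = 0` for `a ≠ b`. -/
theorem δ_mul_δ_of_ne {a b : Idx} (h : a ≠ b) (μ : Idx) : δ μ a * δ μ b = 0 := by
  by_cases hμ : μ = a
  · subst hμ; rw [δ_of_ne h]; ring
  · rw [δ_of_ne hμ]; ring

/-- [folklore] `|e_a + e_b|² = 2` for `a ≠ b`. -/
theorem nsq_e_add_e {a b : Idx} (h : a ≠ b) : nsq (fun i => e a i + e b i) = 2 := by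
  unfold nsq e
  simp [mul_add, Finset.sum_add_distrib, Finset.sum_ite_eq', Finset.mem_univ, h, h.symm]
  norm_num

/-- [folklore] `Q(e_a + e_b)_{μν}` for `a ≠ b` in closed form. -/
theorem quadGerm_e_add_e {a b : Idx} (h : a ≠ b) (μ ν : Idx) :
    quadGerm cQ α γ (fun i => e a i + e b i) μ ν = cQ * (2 * δ μ ν - (δ μ a + δ μ b) * (δ ν a + δ ν b))
      + α * ((δ μ a + δ μ b) * (δ ν a + δ ν b)) + γ * (δ μ ν * ((δ μ a + δ μ b) * (δ μ a + δ μ b))) := by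
  have h1 : e a μ = δ μ a := rfl
  have h2 : e b μ = δ μ b := rfl
  have h3 : e a ν = δ ν a := rfl
  have h4 : e b ν = δ ν b := rfl
  rw [quadGerm, nsq_e_add_e h, h1, h2, h3, h4]

/-! ## §2 The Ward identity against `quadGerm cQ α γ` evaluated -/

/-- [our object] (W1) Ward at `(p,q) = (e_a, 0)`: the diagonal of the `p`-block, `L μν aa 0 = Q(e_a)_{μν}`. -/
theorem ward_diag0 (hW : WardGerm L (quadGerm cQ α γ)) (μ ν a : Idx) :
    L μ ν a a 0 = cQ * (δ μ ν - δ μ a * δ ν a) + α * (δ μ a * δ ν a) + γ * (δ μ ν * (δ μ a * δ μ a)) := by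
  have h1 := hW (e a) (fun _ => 0) μ ν
  rw [quadGerm_zero, quadGerm_e] at h1
  simp [e, Finset.sum_ite_eq', Finset.mem_univ] at h1
  linarith

/-- [our object] (W1′) Ward at `(0, e_a)`: the diagonal of the `q`-block, `L μν aa 1 = −Q(e_a)_{μν}`. -/
theorem ward_diag1 (hW : WardGerm L (quadGerm cQ α γ)) (μ ν a : Idx) :
    L μ ν a a 1 = -(cQ * (δ μ ν - δ μ a * δ ν a) + α * (δ μ a * δ ν a) + γ * (δ μ ν * (δ μ a * δ μ a))) := by
  have h1 := hW (fun _ => 0) (e a) μ ν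
  rw [quadGerm_zero, quadGerm_e] at h1
  simp [e, Finset.sum_ite_eq', Finset.mem_univ] at h1
  linarith

/-- [our object] (W5) Ward at `(e_a, e_b)`: the `q`-block is minus the `(λ,κ)`-transpose of the `p`-block (no mixed `p_a q_b` term on the right). -/
theorem ward_mix (hW : WardGerm L (quadGerm cQ α γ)) (μ ν a b : Idx) :
    L μ ν a b 1 = -L μ ν b a 0 := by
  have h1 := hW (e a) (e b) μ ν
  rw [quadGerm_e, quadGerm_e] at h1
  simp [e, add_mul, mul_add, Finset.sum_add_distrib, Finset.sum_ite_eq', Finset.mem_univ] at h1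
  have h2 := ward_diag0 hW μ ν a
  have h3 := ward_diag1 hW μ ν b
  linarith

/-- [our object] (W2) Ward at `(e_a + e_b, 0)`, `a ≠ b`: the `(λ,κ)`-symmetric part of the `p`-block (the `γ`-invariant drops out). -/
theorem ward_sym (hW : WardGerm L (quadGerm cQ α γ)) (μ ν : Idx) {a b : Idx} (h : a ≠ b) :
    L μ ν a b 0 + L μ ν b a 0 = -((cQ - α) * (δ μ a * δ ν b + δ μ b * δ ν a)) := by
  have h1 := hW (fun i => e a i + e b i) (fun _ => 0) μ ν
  rw [quadGerm_zero, quadGerm_e_add_e h] at h1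
  simp [e, add_mul, mul_add, Finset.sum_add_distrib, Finset.sum_ite_eq', Finset.mem_univ] at h1
  have h2 := ward_diag0 hW μ ν a
  have h3 := ward_diag0 hW μ ν b
  have h4 : γ * (δ μ ν * (δ μ a * δ μ b)) = 0 := by rw [δ_mul_δ_of_ne h μ]; ring
  have h5 : γ * (δ μ ν * (δ μ b * δ μ a)) = 0 := by rw [δ_mul_δ_of_ne (Ne.symm h) μ]; ring
  linarith

/-! ## §3 THE UNIQUENESS THEOREM AT THE MINIMAL HYPOTHESIS SET -/

/-- [our object] The `p`-block of `ymGerm` in closed form. -/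
theorem ymGerm_zero_eq (μ ν lam κ : Idx) :
    ymGerm μ ν lam κ 0 = δ μ ν * δ lam κ + δ ν lam * δ μ κ - 2 * (δ lam μ * δ ν κ) := by
  simp only [ymGerm, Fin.isValue, ↓reduceIte]

/-- [our object] The `q`-block of `ymGerm` in closed form. -/
theorem ymGerm_one_eq' (μ ν lam κ : Idx) :
    ymGerm μ ν lam κ 1 = -(δ μ ν * δ lam κ) + 2 * (δ ν lam * δ μ κ) - δ lam μ * δ ν κ := by
  simp only [ymGerm, Fin.isValue, one_ne_zero, ↓reduceIte]

/-- [our object] `ymGerm` has the shape (W5) forces: its `q`-block is minus the `(λ,κ)`-transpose of its `p`-block. -/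
theorem ymGerm_one_eq (μ ν lam κ : Idx) : ymGerm μ ν lam κ 1 = -ymGerm μ ν κ lam 0 := by
  rw [ymGerm_one_eq', ymGerm_zero_eq, δ_comm κ lam, δ_comm κ μ, δ_comm μ lam]
  ring

/-- [our object] **UNIQUENESS OF THE MARGINAL CUBIC GAUGE VERTEX FROM WARD + HALF OF ONE BOSE EXCHANGE.**  A cubic germ whose `p`-block is symmetric under
the exchange of legs 1 and 3 (`L λ ν μ κ 0 = L μ ν λ κ 0`, the `p`-part of `Anti13`) and which satisfies the tree-level Ward identity against the isotropic
transverse quadratic germ `cQ·(|k|²δ − kk)` IS `cQ · ymGerm`.  No reflection, permutation or 1 ↔ 2 exchange hypothesis. -/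
theorem cubic_eq_of_anti13p_ward (h13p : ∀ μ ν lam κ : Idx, L lam ν μ κ 0 = L μ ν lam κ 0)
    (hW : WardGerm L (quadGerm cQ 0 0)) (μ ν lam κ : Idx) (i : Fin 2) :
    L μ ν lam κ i = cQ * ymGerm μ ν lam κ i := by
  have key : ∀ μ ν lam κ : Idx, L μ ν lam κ 0 = cQ * ymGerm μ ν lam κ 0 := by
    intro μ ν lam κ
    rw [ymGerm_zero_eq]
    by_cases hlk : lam = κ
    · -- `(λ,κ)`-diagonal: (W1)
      subst hlk
      rw [ward_diag0 hW μ ν lam, δ_self, δ_comm ν lam, δ_comm lam μ]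
      ring
    · by_cases hmk : μ = κ
      · -- `L μ ν λ μ 0 = L λ ν μ μ 0` by the exchange, then (W1)
        subst hmk
        rw [h13p lam ν μ μ, ward_diag0 hW lam ν μ, δ_self, δ_of_ne hlk, δ_comm lam ν]
        ring
      · by_cases hml : lam = μ
        · -- `L λ ν λ κ 0`: (W2) on the pair `(λ,κ)` and the exchange + (W1) on the partner
          subst hml
          have e1 := ward_sym hW lam ν hmk
          have e2 := h13p κ ν lam lam
          have e3 := ward_diag0 hW κ ν lam
          rw [δ_self, δ_of_ne hmk] at e1
          rw [δ_of_ne (Ne.symm hmk), δ_comm κ ν] at e3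
          rw [δ_self, δ_of_ne hmk]
          linarith
        · -- `μ, λ, κ` pairwise distinct: the six-step chain exchange/(W2) returns `X ↦ −X`
          have s1 := h13p lam ν μ κ
          have s2 := ward_sym hW lam ν hmk
          have s3 := h13p lam ν κ μ
          have s4 := ward_sym hW κ ν hml
          have s5 := h13p κ ν μ lam
          have s6 := ward_sym hW μ ν (Ne.symm hlk)
          rw [δ_of_ne hml, δ_of_ne hlk] at s2
          rw [δ_of_ne (Ne.symm hlk), δ_of_ne (Ne.symm hmk)] at s4
          rw [δ_of_ne hmk, δ_of_ne (Ne.symm hml)] at s6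
          rw [δ_of_ne hlk, δ_of_ne hmk, δ_of_ne hml]
          linarith
  revert i
  refine Fin.forall_fin_two.mpr ⟨key μ ν lam κ, ?_⟩
  rw [ward_mix hW μ ν lam κ, key μ ν κ lam, ymGerm_one_eq]
  ring

/-- [our object] Normalised form (`cQ = 1`, the perfect Laplacian's germ). -/
theorem cubic_eq_ym_of_anti13p_ward (h13p : ∀ μ ν lam κ : Idx, L lam ν μ κ 0 = L μ ν lam κ 0)
    (hW : WardGerm L (quadGerm 1 0 0)) : L = ymGerm := by
  funext μ ν lam κ i
  rw [cubic_eq_of_anti13p_ward h13p hW μ ν lam κ i, one_mul]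

/-- [our object] In particular from `Anti13` + Ward. -/
theorem cubic_eq_of_anti13_ward (h13 : Anti13 L) (hW : WardGerm L (quadGerm cQ 0 0)) (μ ν lam κ : Idx) (i : Fin 2) :
    L μ ν lam κ i = cQ * ymGerm μ ν lam κ i :=
  cubic_eq_of_anti13p_ward h13.1 hW μ ν lam κ i

/-- [our object] **WARD AGAINST THE GENERAL `B₄`-INVARIANT QUADRATIC GERM: `Anti13` alone kills the longitudinal (`α`) and the non-covariant (`γ`) invariant.**
(Mechanism: `L 0 1 1 0 0 = L 1 1 0 0 0 = Q(e₀)₁₁ = cQ` by the `p`-part; the `q`-part + (W5) give `L 0 1 0 1 0 = −2cQ`; (W2) then reads `−cQ = −(cQ − α)`;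
and `L 0 0 0 0 0 = α + γ` (W1) against `L 0 0 0 0 0 = 0` (`q`-part + (W5)).  The exact engine: the `p`-part alone does NOT suffice here — nullity 3.) -/
theorem alpha_gamma_eq_zero_of_anti13_ward (h13 : Anti13 L) (hW : WardGerm L (quadGerm cQ α γ)) : α = 0 ∧ γ = 0 := by
  have a1 := ward_diag0 hW 1 1 0
  have a2 := h13.1 0 1 1 0
  have e1 := h13.2 0 1 1 0
  have e2 := ward_mix hW 1 1 0 0
  have e3 := ward_mix hW 0 1 1 0
  have a4 := ward_sym hW 0 1 (show (0 : Idx) ≠ 1 by decide)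
  have g1 := ward_diag0 hW 0 0 0
  have g2 := h13.2 0 0 0 0
  have g3 := ward_mix hW 0 0 0 0
  simp [δ] at a1 a4 g1
  have hα : α = 0 := by linarith
  exact ⟨hα, by linarith⟩

/-- [our object] **STRENGTHENING OF `WardNormalisation.cubic_eq_of_symmetric_ward`** (which assumed `PermInvariant ∧ FlipInvariant ∧ Anti12 ∧ Anti13`):
`Anti13` + Ward against `quadGerm cQ α γ` ⟹ `L = cQ · ymGerm ∧ α = 0 ∧ γ = 0`. -/
theorem cubic_eq_of_anti13_ward_general (h13 : Anti13 L) (hW : WardGerm L (quadGerm cQ α γ)) :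
    (∀ μ ν lam κ i, L μ ν lam κ i = cQ * ymGerm μ ν lam κ i) ∧ α = 0 ∧ γ = 0 := by
  obtain ⟨hα, hγ⟩ := alpha_gamma_eq_zero_of_anti13_ward h13 hW
  subst hα hγ
  exact ⟨fun μ ν lam κ i => cubic_eq_of_anti13_ward h13 hW μ ν lam κ i, rfl, rfl⟩

-- The owner's headline `MarginalUniquenessWard.cubic_eq_of_flip_bose_ward` recovered with `hF` and `h12` NOT consumed (an `example`, so as not to
-- restate the landed declaration):
example (_hF : FlipInvariant L) (_h12 : Anti12 L) (h13 : Anti13 L) (hW : WardGerm L (quadGerm cQ 0 0))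
    (μ ν lam κ : Idx) (i : Fin 2) : L μ ν lam κ i = cQ * ymGerm μ ν lam κ i :=
  cubic_eq_of_anti13_ward h13 hW μ ν lam κ i

/-- [our object] IFF at the minimal hypothesis set: the two rows single out `ymGerm` EXACTLY. -/
theorem anti13p_ward_iff (L : CubicGerm) :
    ((∀ μ ν lam κ : Idx, L lam ν μ κ 0 = L μ ν lam κ 0) ∧ WardGerm L (quadGerm 1 0 0)) ↔ L = ymGerm := by
  constructor
  · rintro ⟨h13p, hW⟩; exact cubic_eq_ym_of_anti13p_ward h13p hW
  · rintro rfl; exact ⟨ymGerm_anti13₀, wardGerm_ymGerm⟩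

/-! ## §4 NON-VACUITY of the owner's hypothesis set -/

/-- [folklore] `rs α β = ±1`. -/
theorem rs_mul_self (α β : Idx) : rs α β * rs α β = 1 := by
  unfold rs; split_ifs <;> norm_num

/-- [folklore] A product `δ_{μν} δ_{λκ}` is reflection invariant (each axis has even multiplicity where it is nonzero). -/
theorem flip_dd (α μ ν lam κ : Idx) :
    rs α μ * rs α ν * rs α lam * rs α κ * (δ μ ν * δ lam κ) = δ μ ν * δ lam κ := by
  by_cases h1 : μ = ν
  · subst h1
    by_cases h2 : lam = κ
    · subst h2
      have hμ := rs_mul_self α μ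
      have hl := rs_mul_self α lam
      calc rs α μ * rs α μ * rs α lam * rs α lam * (δ μ μ * δ lam lam)
          = (rs α μ * rs α μ) * (rs α lam * rs α lam) * (δ μ μ * δ lam lam) := by ring
        _ = δ μ μ * δ lam lam := by rw [hμ, hl]; ring
    · rw [δ_of_ne h2]; ring
  · rw [δ_of_ne h1]; ring

/-- [our object] **The Yang–Mills germ is reflection invariant** (the one clause of the owner's hypothesis set not previously recorded in kernel). -/
theorem flipInvariant_ymGerm : FlipInvariant ymGerm := by
  intro α μ ν lam κ
  have h1 := flip_dd α μ ν lam κ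
  have h2 : rs α μ * rs α ν * rs α lam * rs α κ * (δ ν lam * δ μ κ) = δ ν lam * δ μ κ := by
    have := flip_dd α ν lam μ κ
    calc rs α μ * rs α ν * rs α lam * rs α κ * (δ ν lam * δ μ κ)
        = rs α ν * rs α lam * rs α μ * rs α κ * (δ ν lam * δ μ κ) := by ring
      _ = δ ν lam * δ μ κ := this
  have h3 : rs α μ * rs α ν * rs α lam * rs α κ * (δ lam μ * δ ν κ) = δ lam μ * δ ν κ := by
    have := flip_dd α lam μ ν κ
    calc rs α μ * rs α ν * rs α lam * rs α κ * (δ lam μ * δ ν κ)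
        = rs α lam * rs α μ * rs α ν * rs α κ * (δ lam μ * δ ν κ) := by ring
      _ = δ lam μ * δ ν κ := this
  refine Fin.forall_fin_two.mpr ⟨?_, ?_⟩
  · rw [ymGerm_zero_eq]
    linear_combination h1 + h2 - 2 * h3
  · rw [ymGerm_one_eq']
    linear_combination -h1 + 2 * h2 - h3

/-- [our object] … and so is every multiple `c · ymGerm`. -/
theorem flipInvariant_smul_ymGerm (c : ℝ) : FlipInvariant (fun μ ν lam κ i => c * ymGerm μ ν lam κ i) := by
  intro α μ ν lam κ i
  have h := flipInvariant_ymGerm α μ ν lam κ i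
  calc rs α μ * rs α ν * rs α lam * rs α κ * (c * ymGerm μ ν lam κ i)
      = c * (rs α μ * rs α ν * rs α lam * rs α κ * ymGerm μ ν lam κ i) := by ring
    _ = c * ymGerm μ ν lam κ i := by rw [h]

/-- [our object] `c · ymGerm` is 1 ↔ 2 antisymmetric. -/
theorem anti12_smul_ymGerm (c : ℝ) : Anti12 (fun μ ν lam κ i => c * ymGerm μ ν lam κ i) := by
  refine ⟨fun μ ν lam κ => ?_, fun μ ν lam κ => ?_⟩
  · have h := ymGerm_anti12.1 μ ν lam κ
    calc c * ymGerm ν μ lam κ 1 = c * (-ymGerm μ ν lam κ 0) := by rw [h]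
      _ = -(c * ymGerm μ ν lam κ 0) := by ring
  · have h := ymGerm_anti12.2 μ ν lam κ
    calc c * ymGerm ν μ lam κ 0 = c * (-ymGerm μ ν lam κ 1) := by rw [h]
      _ = -(c * ymGerm μ ν lam κ 1) := by ring

/-- [our object] `c · ymGerm` is 1 ↔ 3 antisymmetric. -/
theorem anti13_smul_ymGerm (c : ℝ) : Anti13 (fun μ ν lam κ i => c * ymGerm μ ν lam κ i) := by
  refine ⟨fun μ ν lam κ => ?_, fun μ ν lam κ => ?_⟩
  · have h := ymGerm_anti13.1 μ ν lam κ
    show c * ymGerm lam ν μ κ 0 = c * ymGerm μ ν lam κ 0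
    rw [h]
  · have h := ymGerm_anti13.2 μ ν lam κ
    show c * ymGerm lam ν μ κ 1 - c * ymGerm lam ν μ κ 0 = -(c * ymGerm μ ν lam κ 1)
    calc c * ymGerm lam ν μ κ 1 - c * ymGerm lam ν μ κ 0 = c * (ymGerm lam ν μ κ 1 - ymGerm lam ν μ κ 0) := by ring
      _ = c * (-ymGerm μ ν lam κ 1) := by rw [h]
      _ = -(c * ymGerm μ ν lam κ 1) := by ring

/-- [our object] **THE OWNER'S HYPOTHESIS SET IS INHABITED** — by `cQ · ymGerm`; the conclusion of `cubic_eq_of_flip_bose_ward` is attained. -/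
theorem exists_flip_bose_ward (cQ : ℝ) :
    ∃ L : CubicGerm, FlipInvariant L ∧ Anti12 L ∧ Anti13 L ∧ WardGerm L (quadGerm cQ 0 0) :=
  ⟨fun μ ν lam κ i => cQ * ymGerm μ ν lam κ i,
    flipInvariant_smul_ymGerm cQ, anti12_smul_ymGerm cQ, anti13_smul_ymGerm cQ, wardGerm_smul_ymGerm cQ⟩

/-- [our object] IFF form of the owner's theorem at `cQ = 1`: the four rows single out `ymGerm` EXACTLY. -/
theorem flip_bose_ward_iff (L : CubicGerm) :
    (FlipInvariant L ∧ Anti12 L ∧ Anti13 L ∧ WardGerm L (quadGerm 1 0 0)) ↔ L = ymGerm := by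
  constructor
  · rintro ⟨hF, h12, h13, hW⟩; exact cubic_eq_ym_of_flip_bose_ward hF h12 h13 hW
  · rintro rfl; exact ⟨flipInvariant_ymGerm, ymGerm_anti12, ymGerm_anti13, wardGerm_ymGerm⟩

/-! ## §5 TIGHTNESS: the 1 ↔ 3 exchange cannot be dropped -/

-- The Ward-trivial germ `x_{μνλκ} = δ_{μλ}δ_{νκ} − δ_{μκ}δ_{νλ}` (same `p`- and `q`-block; `Φ_x = (B¹∧B²)·(B³∧(p+q))`) is written INLINE below
-- (no `def`, no notation): the family is `L_t μ ν λ κ i = ymGerm μ ν λ κ i + t · (δ_{μλ}δ_{νκ} − δ_{μκ}δ_{νλ})`.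

/-- [our object] For every `t`, `ymGerm + t·x` satisfies the Ward identity against `quadGerm 1 0 0` (`x` contracts to `r ∧ r = 0`). -/
theorem wardGerm_ym_add_x (t : ℝ) :
    WardGerm (fun μ ν lam κ i => ymGerm μ ν lam κ i + t * (δ μ lam * δ ν κ - δ μ κ * δ ν lam)) (quadGerm 1 0 0) := by
  intro p q μ ν
  fin_cases μ <;> fin_cases ν <;>
    simp [Fin.sum_univ_four, ymGerm, quadGerm, δ, nsq] <;> ring

/-- [our object] `ymGerm + t·x` is invariant under axis permutations. -/
theorem permInvariant_ym_add_x (t : ℝ) :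
    PermInvariant (fun μ ν lam κ i => ymGerm μ ν lam κ i + t * (δ μ lam * δ ν κ - δ μ κ * δ ν lam)) := by
  intro σ μ ν lam κ i
  simp only [ymGerm, δ_perm]

/-- [our object] `ymGerm + t·x` is invariant under axis reflections. -/
theorem flipInvariant_ym_add_x (t : ℝ) :
    FlipInvariant (fun μ ν lam κ i => ymGerm μ ν lam κ i + t * (δ μ lam * δ ν κ - δ μ κ * δ ν lam)) := by
  intro α μ ν lam κ i
  have h0 := flipInvariant_ymGerm α μ ν lam κ i
  have h1 : rs α μ * rs α ν * rs α lam * rs α κ * (δ μ lam * δ ν κ) = δ μ lam * δ ν κ := by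
    have := flip_dd α μ lam ν κ
    calc rs α μ * rs α ν * rs α lam * rs α κ * (δ μ lam * δ ν κ)
        = rs α μ * rs α lam * rs α ν * rs α κ * (δ μ lam * δ ν κ) := by ring
      _ = δ μ lam * δ ν κ := this
  have h2 : rs α μ * rs α ν * rs α lam * rs α κ * (δ μ κ * δ ν lam) = δ μ κ * δ ν lam := by
    have := flip_dd α μ κ ν lam
    calc rs α μ * rs α ν * rs α lam * rs α κ * (δ μ κ * δ ν lam)
        = rs α μ * rs α κ * rs α ν * rs α lam * (δ μ κ * δ ν lam) := by ring
      _ = δ μ κ * δ ν lam := this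
  show rs α μ * rs α ν * rs α lam * rs α κ * (ymGerm μ ν lam κ i + t * (δ μ lam * δ ν κ - δ μ κ * δ ν lam))
    = ymGerm μ ν lam κ i + t * (δ μ lam * δ ν κ - δ μ κ * δ ν lam)
  linear_combination h0 + t * h1 - t * h2

/-- [our object] `ymGerm + t·x` is 1 ↔ 2 Bose antisymmetric. -/
theorem anti12_ym_add_x (t : ℝ) :
    Anti12 (fun μ ν lam κ i => ymGerm μ ν lam κ i + t * (δ μ lam * δ ν κ - δ μ κ * δ ν lam)) := by
  refine ⟨fun μ ν lam κ => ?_, fun μ ν lam κ => ?_⟩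
  · have h1 := ymGerm_anti12.1 μ ν lam κ
    show ymGerm ν μ lam κ 1 + t * (δ ν lam * δ μ κ - δ ν κ * δ μ lam) = -(ymGerm μ ν lam κ 0 + t * (δ μ lam * δ ν κ - δ μ κ * δ ν lam))
    linear_combination h1
  · have h1 := ymGerm_anti12.2 μ ν lam κ
    show ymGerm ν μ lam κ 0 + t * (δ ν lam * δ μ κ - δ ν κ * δ μ lam) = -(ymGerm μ ν lam κ 1 + t * (δ μ lam * δ ν κ - δ μ κ * δ ν lam))
    linear_combination h1

/-- [our object] **TIGHTNESS WITNESS.**  For `t ≠ 0` the germ `ymGerm + t·x` is permutation invariant, reflection invariant, 1 ↔ 2 antisymmetric and Ward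
against `quadGerm 1 0 0` — and is NOT `ymGerm`: WITHOUT the 1 ↔ 3 exchange the uniqueness FAILS even with the full hyperoctahedral symmetry.  (The exact
engines: {Flip, Anti12, Ward} leaves a 6-parameter family — one `t_{ab}` per unordered axis pair; with `PermInvariant` added exactly its isotropic line
`ymGerm + t·x` survives — exhibited here.  v1.0.1 DOCFIX of this sentence and of the header after XREAD C-ne5leaf02-44; code byte-identical to v1.) -/
theorem not_unique_without_anti13 {t : ℝ} (ht : t ≠ 0) :
    let L : CubicGerm := fun μ ν lam κ i => ymGerm μ ν lam κ i + t * (δ μ lam * δ ν κ - δ μ κ * δ ν lam)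
    PermInvariant L ∧ FlipInvariant L ∧ Anti12 L ∧ WardGerm L (quadGerm 1 0 0) ∧ L ≠ ymGerm := by
  refine ⟨permInvariant_ym_add_x t, flipInvariant_ym_add_x t, anti12_ym_add_x t, wardGerm_ym_add_x t, ?_⟩
  intro h
  have h1 := congrFun (congrFun (congrFun (congrFun (congrFun h 0) 1) 0) 1) 0
  have h2 : δ (0 : Idx) 0 * δ (1 : Idx) 1 - δ (0 : Idx) 1 * δ (1 : Idx) 0 = 1 := by simp [δ]
  simp only [h2, mul_one] at h1
  exact ht (by linarith)

end Summit.QuantumFields.BalabanUV.Beta.FP.MarginalUniquenessWardMinimal
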